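import Summits.HodgeConjecture.HodgeConjecture.Theses.AnchorTransport
import Summits.HodgeConjecture.HodgeConjecture.Theorems.AnchorTransportVariationalHodgeStubDominanceForm
import Literature.AlgebraicGeometry.HodgeTheory.AlgebraicityLocusIUnionClosedProofs
import HarnessLib

/-!
# Route AnchorTransport — `VariationalHodge` (stmt-HodgeConjecture-1076), line `polar-patch-broken-cycles`: stub `stub_dominanceAlongSmooth`

The registered stub `stub_dominanceAlongSmooth` (S3, "the engine, closing half") of the line skeleton
`Cruxes/VariationalHodge/Lines/polar_patch_broken_cycles.lean`, proved UNCONDITIONALLY.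

**Statement.** Let `f : 𝒳 ⟶ S` be a smooth projective family of relative dimension `n`
(`Motives.IsSmoothProjectiveFamily`) with quasi-projective total space `𝒳` over a smooth irreducible
affine `ℂ`-scheme `S`, `A ∈ H²ᵖ(𝒳(ℂ); ℂ)` a global class, `π : V ⟶ S` a morphism of `ℂ`-schemes
whose underlying morphism of schemes is SMOOTH, and `U ⊆ V` a non-empty Zariski open such that
`A|_{𝒳_{π t'}}` is algebraic for every complex point `t'` of `V` over `U`. Then `A|_{𝒳_t}` is
algebraic for EVERY complex point `t` of `S`.

**Proof.**
1. `π` is smooth, hence flat and locally of finite presentation, hence universally open (Mathlib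
   `UniversallyOpen.of_flat`, EGA IV₂ 2.4.6, Stacks 01UA); so `W := π(U) ⊆ S` is a non-empty
   Zariski open of `S` (`Scheme.Hom.isOpenMap`).
2. A complex point `t` of `S` over `W` lifts to a complex point `t'` of `V` over `U` with `π t' = t`:
   `V` is locally of finite type over `ℂ` (`π` and `S → Spec ℂ` are), hence Jacobson (Mathlib
   `LocallyOfFiniteType.jacobsonSpace`); the locally closed subset `U ∩ π⁻¹(pt t)` of `V` is
   non-empty (as `pt t ∈ π(U)`), so it contains a closed point (`nonempty_inter_closedPoints`), which
   underlies a complex point `t'` (Nullstellensatz, `Motives.ComplexPoints.equivClosedPoints`); and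
   complex points of `S` with the same underlying closed point coincide, so `π t' = t`
   (`Motives.AlgPoints.pt_map`). Hence `A|_{𝒳_t} = A|_{𝒳_{π t'}}` is algebraic for all `t` over `W`.
3. The dominance form over smooth irreducible affine bases with quasi-projective total space,
   `Theorems.dominanceForm_of_isQuasiProjectiveOver` (algebraic at all complex points over a
   non-empty Zariski open `W ⊆ S` ⇒ algebraic everywhere; Baire category on `S(ℂ)` and the structure
   of the algebraicity locus as a countable union of complex points of Zariski-closed subsets), fed
   with the tree's theorem `HodgeTheory.charlesSchnell_algebraicityLocus_iUnion_closed_holds`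
   (Charles–Schnell, Prop. 11.3.11; discharged in
   `Literature/AlgebraicGeometry/HodgeTheory/AlgebraicityLocusIUnionClosedProofs`), concludes.

## References

* F. Charles, C. Schnell, *Notes on absolute Hodge classes* (2014), Prop. 11.3.11 (the locus of
  algebraicity of a flat section is a countable union of closed algebraic subsets).
* C. Voisin, *Hodge Theory and Complex Algebraic Geometry II* (2003), §7.3.2, proof of Thm. 7.19.
* A. Grothendieck, J. Dieudonné, EGA IV₂, Publ. Math. IHÉS 24 (1965), Thm. 2.4.6 (flat morphisms
  locally of finite presentation are universally open); The Stacks Project, Tag 01UA.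
-/

noncomputable section

-- every declaration of this problem lives in `Summit.HodgeConjecture.HodgeConjecture.…` (summit = sub-problem)
set_option linter.dupNamespace false

open CategoryTheory CategoryTheory.Limits AlgebraicGeometry TopologicalSpace
open Literature.AlgebraicGeometry.Motives Literature.AlgebraicGeometry.HodgeTheory
open Summit.HodgeConjecture.HodgeConjecture.Theses.AnchorTransport

namespace Summit.HodgeConjecture.HodgeConjecture.Theorems

/-- **A complex point over the image of an open lifts to a complex point in the open.** For a
morphism `π : V ⟶ S` of `ℂ`-schemes with `S` and `π` locally of finite type, an open `U ⊆ V` and a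
complex point `t` of `S` with `pt t ∈ π(U)`, there is a complex point `t'` of `V` with `pt t' ∈ U`
and `π t' = t`: the non-empty locally closed subset `U ∩ π⁻¹(pt t)` of the Jacobson space `V`
(Mathlib `LocallyOfFiniteType.jacobsonSpace`) contains a closed point
(`nonempty_inter_closedPoints`), which underlies a complex point (Nullstellensatz,
`Motives.ComplexPoints.equivClosedPoints`), and complex points with the same underlying point
coincide. [folklore] -/
theorem exists_complexPoints_map_eq_of_pt_mem_image {V S : SchemeOver ℂ} (π : V ⟶ S)
    [LocallyOfFiniteType S.hom] [LocallyOfFiniteType π.left] {U : Set V.left} (hU : IsOpen U)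
    (t : ComplexPoints S) (ht : t.pt ∈ (π.left : V.left → S.left) '' U) :
    ∃ t' : ComplexPoints V, t'.pt ∈ U ∧ AlgPoints.map π t' = t := by
  -- `V` is locally of finite type over `ℂ`, hence Jacobson
  haveI : LocallyOfFiniteType V.hom := by rw [← Over.w π]; infer_instance
  haveI : JacobsonSpace V.left := LocallyOfFiniteType.jacobsonSpace V.hom
  -- the locally closed `U ∩ π⁻¹(pt t)` is non-empty, so it contains a closed point `q`
  obtain ⟨x, hxU, hx⟩ := ht
  have hfib : IsClosed (π.left ⁻¹' ({t.pt} : Set S.left)) :=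
    (ComplexPoints.isClosed_pt t).preimage π.left.continuous
  obtain ⟨q, ⟨hqU, hq⟩, hqc⟩ := nonempty_inter_closedPoints (X := ↥V.left)
    (Z := U ∩ π.left ⁻¹' ({t.pt} : Set S.left)) ⟨x, hxU, hx⟩
    (hU.isLocallyClosed.inter hfib.isLocallyClosed)
  -- `q` underlies a complex point `t'` of `V`
  set t' : ComplexPoints V := (ComplexPoints.equivClosedPoints V).symm ⟨q, hqc⟩ with ht'def
  have ht' : t'.pt = q := by
    have h := ComplexPoints.coe_equivClosedPoints_apply V t'
    rw [ht'def, Equiv.apply_symm_apply] at h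
    exact h.symm
  refine ⟨t', ht' ▸ hqU, ?_⟩
  -- complex points of `S` with the same underlying point coincide
  apply (ComplexPoints.equivClosedPoints S).injective
  apply Subtype.ext
  rw [ComplexPoints.coe_equivClosedPoints_apply, ComplexPoints.coe_equivClosedPoints_apply,
    AlgPoints.pt_map, ht']
  exact Set.mem_singleton_iff.mp (Set.mem_preimage.mp hq)

/-- **Stub `stub_dominanceAlongSmooth` of line `polar-patch-broken-cycles`** (S3, the closing half of
the engine; the typed statement `DominanceAlongSmooth`): for a smooth projective family `f : 𝒳 ⟶ S`
of relative dimension `n` with quasi-projective total space over a smooth irreducible affine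
`ℂ`-scheme `S`, a global class `A ∈ H²ᵖ(𝒳(ℂ); ℂ)`, a morphism `π : V ⟶ S` of `ℂ`-schemes with
`π` smooth, and a non-empty Zariski open `U ⊆ V` such that `A|_{𝒳_{π t'}}` is algebraic for all
complex points `t'` of `V` over `U`, the restriction `A|_{𝒳_t}` is algebraic at EVERY complex point
`t` of `S`. Proof: `π` is flat and locally of finite presentation, hence open (Mathlib
`UniversallyOpen.of_flat`, `Scheme.Hom.isOpenMap`), so `W := π(U)` is a non-empty Zariski open of
`S`; every complex point of `S` over `W` lifts to a complex point of `V` over `U`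
(`exists_complexPoints_map_eq_of_pt_mem_image`: Jacobson schemes and the Nullstellensatz), so `A`
is algebraic on the fibres over `W`; and the dominance form
`dominanceForm_of_isQuasiProjectiveOver`, granted the tree's theorem
`charlesSchnell_algebraicityLocus_iUnion_closed_holds`, spreads algebraicity from `W` to all of `S`.
[cite: CharlesSchnell2014Notes, Prop. 11.3.11 (proof)]
[cite: VoisinHodgeII2003, §7.3.2, proof of Thm. 7.19] [cite: EGAIV2, Thm. 2.4.6]
[cite: StacksProject, Tag 01UA] -/
theorem stub_dominanceAlongSmooth :
    ∀ ⦃n : ℕ⦄ ⦃𝒳 S : SchemeOver ℂ⦄ (f : 𝒳 ⟶ S), IsSmoothProjectiveFamily f n →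
      IsQuasiProjectiveOver 𝒳 → IrreducibleSpace S.left → IsAffine S.left →
      AlgebraicGeometry.Smooth S.hom →
      ∀ (p : ℕ) (A : complexBetti 𝒳 (2 * p)) (V : SchemeOver ℂ) (π : V ⟶ S),
      AlgebraicGeometry.Smooth π.left →
      ∀ (U : Set V.left), IsOpen U → U.Nonempty →
      (∀ t' : ComplexPoints V, t'.pt ∈ U →
        complexBetti.map (fiberι f (AlgPoints.map π t')) (2 * p) A ∈
          algebraicClasses (fiberOver f (AlgPoints.map π t')) p) →
      ∀ t : ComplexPoints S,
        complexBetti.map (fiberι f t) (2 * p) A ∈ algebraicClasses (fiberOver f t) p := by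
  intro n 𝒳 S f hf hqp hirr haff hsm p A V π hπ U hU hUne hUalg t
  haveI := hirr
  haveI := haff
  haveI := hsm
  haveI := hπ
  -- (1) `W := π(U)` is a non-empty Zariski open of `S`: smooth ⇒ flat + lfp ⇒ universally open
  have hW : IsOpen ((π.left : V.left → S.left) '' U) := π.left.isOpenMap U hU
  have hWne : ((π.left : V.left → S.left) '' U).Nonempty := hUne.image _
  -- (3) the dominance form over the smooth irreducible affine base `S`, granted Charles–Schnell
  refine dominanceForm_of_isQuasiProjectiveOver charlesSchnell_algebraicityLocus_iUnion_closed_holds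
    f hf hqp hirr haff hsm p A _ hW hWne (fun s hs => ?_) t
  -- (2) a complex point `s` over `W` lifts to a complex point `s'` of `V` over `U` with `π s' = s`
  obtain ⟨s', hs'U, rfl⟩ := exists_complexPoints_map_eq_of_pt_mem_image π hU s hs
  exact hUalg s' hs'U

end Summit.HodgeConjecture.HodgeConjecture.Theorems

end
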